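import Literature.MathematicalPhysics.QuantumFieldTheory.Balaban1983to89.B13ResidualSlotProbe
import Literature.MathematicalPhysics.QuantumFieldTheory.Balaban1983to89.Node00.Record9

/-!
# `Balaban1983to89.B13ResidualSlotProbe9` — the N10 slot probe AT NODE 00's STAGE-9 RECORD `Node00.IsRecordOfRecord₉C` (def-T, `Node00/Record9`,
# 2026-08-26): the carrier families `X` ([B8]∕[B10]∕[I]∕[II] groups), `Y` ([B9]), `Z` ([B11]) are STILL residual there (the module's own located remark
# TS-9⁺ ∕ R9-a), the Stage-9 datum, provisos and admissibility do not read them — so, RELATIVE TO ONE ₉C RECORD, the in-edge-guarded refutation of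
# `B13ResidualSlotProbe` repeats verbatim: a ₉C record over the SAME datum with `b9 ∧ b10 ∧ b11 ∧ b12 ∧ ¬ b13` at every run, all four in-edge nodes holding
# and N10 failing; «`∀ D w, IsRecordOfRecord₉C F N D w → ∀ P, Dag.B13_main (leavesP w P)`» (= `YMDAG.UVSplit.S_N10` at ₉C, the N10 conjunct of the
# split-layer cluster child K2 «FlowBounds» read over ₉C) is FALSE as soon as ₉C is inhabited on the family

statement-level bookkeeping over published theorems with citation tags; kernel-checked compositions of tree theorems; nothing here is a claim about
the Yang–Mills mass gap.

Track A, DAG node N10 (KNIT-BY-NAME seat `pub-ymgap-dag-p2` = n10-a, generation 6, 2026-08-26), module 2 of the generation.  BY NAME and UNCHANGED: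
`Node00.Record9` (def-T g2: `Stage9Params`, `.Provisos`, `.Admissible`, `datumOfRecord₉`, `Stage9Params.toStage5`, `IsRecordOfRecord₉C`); module 1
`B13ResidualSlotProbe` (the witness and `exists_stepData_b13Triple`); `B13NodeKnitRecord5C.inEdges_iff_res₅C` ∕ `b13_leaf_iff_res₅C` (the five leaves
`Iff.rfl`-located at the residual carriers of ANY Stage-5 view — here the view `θ.toStage5` of Stage-9 parameters).

§1 BLINDNESS AT STAGE 9 (kernel, `rfl`-level): swapping the residual families `X, Y, Z` of Stage-9 parameters keeps the displayed provisos
(`provisos_updXYZ₉`, field by field), admissibility (`admissible_updXYZ₉`), the DATUM (`datumOfRecord₉_updXYZ`, `rfl`: core, tower, weights, histories read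
`ν, τ9, ppSel, A₁, ζ, εbg, ρ8, bV, v₀, γ, Efl, logz, res.S218, ScorrLaw` only) and commutes with the Stage-5 view (`toStage5_updXYZ₉`, `rfl`); hence
**`isRecordOfRecord₉C_updXYZ`**: re-binding a ₉C record's world to carrier-swapped parameters is again a ₉C record over the SAME datum.
§2 CENSUS AT ₉C, relative to one ₉C record `(D, w)` (inhabitation of ₉C = the plan's analytic item K0 «Record9Inhabited»; nothing here assumes or proves it):
`exists_record₉C_inEdges_not_b13`, `exists_record₉C_sisters_not_b13_main`, `exists_record₉C_b13_main` (the `∃`-dual, vacuous), `not_forall_record₉C_b13_main`,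
`b13_main_undetermined_over_record₉C`.
§3 THE SLOT AT STAGE 9: `not_slot₉` — even WITH the provisos as a premise, «∀ admissible θ with provisos, ∀ P, in-edges at `(θ.toStage5).res` ⇒ the B13 triple»
is FALSE as soon as one admissible Stage-9 parameter with provisos exists.
CONSEQUENCE (plan [YMPLAN-G62-READ-B13SLOT] ∕ dagwriter ∕ node00-def, located): the rev-1 items K0–K3 read no B9–B13 leaf and are untouched; but a ∀-form
node-cluster CHILD («FlowBounds» ∕ `S_N10`) instantiated at `Rec := IsRecordOfRecord₉C` is refutable the moment K0 «Record9Inhabited» lands — the regression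
test of record for the pin: N10 needs the CARRIER-PINNING successor record (at least `(res.X P).S13 ∕ c13` a function of genuine objects — Stage 4(X.B13)) or
stays «from the slot» (displayed, certified-vacuous hypotheses).

HONEST FRAMING: count-neutral; N10 NOT discharged and NOT refuted at Bałaban's objects; degenerate probe carriers; one finite four-torus programme at fixed ε;
nothing continuum ∕ ℝ⁴ ∕ OS ∕ mass-gap ∕ Clay.  0 `sorry`, 0 `def`, standard axioms.
-/

noncomputable section

namespace Literature.MathematicalPhysics.QuantumFieldTheory.Balaban1983to89.B13ResidualSlotProbe9

open DagBinding T4Continuum Node00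
open Literature.MathematicalPhysics.QuantumFieldTheory.Balaban1983to89.B13ResidualLeafProbe (exists_stepData_not_lemma1)
open Literature.MathematicalPhysics.QuantumFieldTheory.Balaban1983to89.B13ResidualSlotProbe (exists_stepData_b13Triple)
open Literature.MathematicalPhysics.QuantumFieldTheory.Balaban1983to89.B11LeafUnpinnedRecord (exists_b11Leaf)
open Literature.MathematicalPhysics.QuantumFieldTheory.Balaban1983to89.B9LeafKnitNonVacuity (exists_b9LeafX_of_vanishing_operators)

variable {F : T4Family} {N : ℕ} [NeZero N]

/-! ## §1 Blindness of the Stage-9 provisos, admissibility and datum to the residual carrier families `X`, `Y`, `Z` -/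

/-- The displayed provisos of the tower of record do not read the residual carrier families (field by field: they read `ν, τ9, ppSel, A₁, ζ`, the generated
histories and `E`, which read `εbg, ρ8, bV, v₀, γ, Efl, logz`). [cite: Balaban1988Convergent, (2.18) p.257 and (3.2)–(3.9) pp.265–266 (bookkeeping: the provisos' dictionary)] -/
theorem provisos_updXYZ₉ {θ : Stage9Params F N} (h : θ.Provisos) (X' : B12.RunParams → PrintedCarriersR)
    (Y' : B12.RunParams → PrintedCarriers9X) (Z' : B12.RunParams → PrintedCarriers11) :
    ({ θ with res := { θ.res with X := X', Y := Y', Z := Z' } } : Stage9Params F N).Provisos :=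
  ⟨h.intPiece, h.measω, h.measChi, h.zetaUnity, h.zetaAbs, fun p k _ hk => h.rstep p k hk⟩

/-- Nor does Stage-9 admissibility (Stage-1 numerics, `γ`, `ν`-windows, `εbg`, the chart clause on `ρ8, bV, cβ`, `τ9.M`). [cite: Balaban1987RG1, (1.20)–(1.21) p.264 (bookkeeping: the admissibility dictionary)] -/
theorem admissible_updXYZ₉ {θ : Stage9Params F N} (hθ : θ.Admissible) (X' : B12.RunParams → PrintedCarriersR)
    (Y' : B12.RunParams → PrintedCarriers9X) (Z' : B12.RunParams → PrintedCarriers11) :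
    ({ θ with res := { θ.res with X := X', Y := Y', Z := Z' } } : Stage9Params F N).Admissible :=
  hθ

/-- **The Stage-9 DATUM is blind to the residual carrier families** (`rfl`: the core of record reads `res.S218` and the θ-keyed plugs only; the tower is the
support-form adapter at the same core, weights and selection). [cite: Balaban1988Convergent, (0.2) p.244 and (2.18) p.257 (bookkeeping: the datum's dictionary)] -/
theorem datumOfRecord₉_updXYZ (θ : Stage9Params F N) (h : θ.Provisos) (X' : B12.RunParams → PrintedCarriersR)
    (Y' : B12.RunParams → PrintedCarriers9X) (Z' : B12.RunParams → PrintedCarriers11) :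
    datumOfRecord₉ F N ({ θ with res := { θ.res with X := X', Y := Y', Z := Z' } } : Stage9Params F N) (provisos_updXYZ₉ h X' Y' Z') =
      datumOfRecord₉ F N θ h := rfl

/-- The Stage-5 view of carrier-swapped Stage-9 parameters is the carrier-swapped Stage-5 view (`residualOfStage9` overwrites `V, βfun, χ, dom, E, R`, actions and
format fields — not `X, Y, Z`; `rfl`). [cite: Balaban1988Convergent, p.244 (bookkeeping: the Stage-9 substitutions)] -/
theorem toStage5_updXYZ₉ (θ : Stage9Params F N) (X' : B12.RunParams → PrintedCarriersR) (Y' : B12.RunParams → PrintedCarriers9X)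
    (Z' : B12.RunParams → PrintedCarriers11) :
    Stage9Params.toStage5 F N ({ θ with res := { θ.res with X := X', Y := Y', Z := Z' } } : Stage9Params F N) =
      { Stage9Params.toStage5 F N θ with res := { (Stage9Params.toStage5 F N θ).res with X := X', Y := Y', Z := Z' } } := rfl

variable {D : FiniteEpsData F (SU N)} {w : WorldP}

/-- **Re-binding a ₉C record's world to carrier-swapped parameters is again a ₉C record over the SAME datum** — the Stage-9 record predicate does not constrain the
[B8]∕[B10]∕[I]∕[II], [B9], [B11] carrier families (its own located remark: they await the carrier-pinning successor record).
[cite: Balaban1988RG2Cluster, Lemmas 1–3 pp.9, 11, 20 (bookkeeping over NODE 00's Stage-9 record predicate: the B13 group is residual)] -/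
theorem isRecordOfRecord₉C_updXYZ (h : IsRecordOfRecord₉C F N D w) :
    ∃ θ : Stage9Params F N, (∀ P, w.up P = upOfRecord₅C F N (θ.toStage5 F N) P) ∧
      ∀ (X' : B12.RunParams → PrintedCarriersR) (Y' : B12.RunParams → PrintedCarriers9X) (Z' : B12.RunParams → PrintedCarriers11),
        IsRecordOfRecord₉C F N D
          { w with up := fun P =>
              upOfRecord₅C F N (Stage9Params.toStage5 F N ({ θ with res := { θ.res with X := X', Y := Y', Z := Z' } } : Stage9Params F N)) P } := by
  obtain ⟨θ, hP, hθ, hD, hC, hγ, hL, hup⟩ := h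
  refine ⟨θ, hup, fun X' Y' Z' => ⟨_, provisos_updXYZ₉ hP X' Y' Z', admissible_updXYZ₉ hθ X' Y' Z', ?_, hC, hγ, hL, fun _ => rfl⟩⟩
  rw [datumOfRecord₉_updXYZ]
  exact hD

/-! ## §2 Census at ₉C, relative to one ₉C record -/

/-- **Given ONE ₉C record, there is a ₉C record over the SAME datum at every run of which the in-edge leaves `b9`, `b10`, `b11`, `b12` HOLD and `b13` FAILS**
(module 1's witness at the Stage-5 view of the swapped Stage-9 parameters). [cite: Balaban1988RG2Cluster, Lemmas 1–3 pp.9, 11, 20; p.1 (in-edges) (typed leaves at NODE 00's Stage-9 record; vacuity probe)] -/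
theorem exists_record₉C_inEdges_not_b13 (h : IsRecordOfRecord₉C F N D w) :
    ∃ w' : WorldP, IsRecordOfRecord₉C F N D w' ∧ ∀ P : B12.RunParams,
      (leavesP w' P).b9 ∧ (leavesP w' P).b10 ∧ (leavesP w' P).b11 ∧ (leavesP w' P).b12 ∧ ¬ (leavesP w' P).b13 := by
  obtain ⟨θ, -, hrec⟩ := isRecordOfRecord₉C_updXYZ h
  obtain ⟨Y₁, -, -, -, hY₁⟩ := exists_b9LeafX_of_vanishing_operators
  obtain ⟨Z₁, -, hZ₁⟩ := exists_b11Leaf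
  let junk : B12.RunParams → B13.StepData := fun P => Classical.choose (exists_stepData_not_lemma1 ((θ.res.X P).c13))
  have hjunk : ∀ P, ¬ B13.Lemma1Printed (junk P) ((θ.res.X P).c13) := fun P =>
    Classical.choose_spec (exists_stepData_not_lemma1 ((θ.res.X P).c13))
  let X' : B12.RunParams → PrintedCarriersR := fun P =>
    { θ.res.X P with I10 := PEmpty, runs10 := (fun i => nomatch i), c12 := ⟨0, 0, 0, 0, 0, 0, 0, 0, 0, 0⟩, S13 := junk P }
  let θ' : Stage5Params F N :=
    Stage9Params.toStage5 F N ({ θ with res := { θ.res with X := X', Y := fun _ => Y₁, Z := fun _ => Z₁ } } : Stage9Params F N)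
  refine ⟨_, hrec X' (fun _ => Y₁) (fun _ => Z₁), fun P => ?_⟩
  have key := B13NodeKnitRecord5C.inEdges_iff_res₅C F N θ' { w with up := fun P => upOfRecord₅C F N θ' P } P rfl
  have h13 := B13NodeKnitRecord5C.b13_leaf_iff_res₅C F N θ' { w with up := fun P => upOfRecord₅C F N θ' P } P rfl
  refine ⟨key.1.2 hY₁, key.2.1.2 ⟨fun _ _ _ _ => ⟨0, (fun i => nomatch i)⟩, (fun i => nomatch i)⟩, key.2.2.1.2 hZ₁,
    key.2.2.2.2 fun hR => absurd hR.1 (lt_irrefl _), fun hb => hjunk P (h13.1 hb).1⟩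

/-- **Given ONE ₉C record, a ₉C record over the same datum at every run of which N06, N08, N07, N09 HOLD and N10 FAILS** — no conjunction of sister stubs rescues
`S_N10` over ₉C either. [cite: Balaban1988RG2Cluster, p.1 and Lemma 3 p.20 (the node at NODE 00's Stage-9 record; vacuity probe)] -/
theorem exists_record₉C_sisters_not_b13_main (h : IsRecordOfRecord₉C F N D w) :
    ∃ w' : WorldP, IsRecordOfRecord₉C F N D w' ∧ ∀ P : B12.RunParams,
      Dag.B9_main (leavesP w' P) ∧ Dag.B10_main (leavesP w' P) ∧ Dag.B11_main (leavesP w' P) ∧ Dag.B12_main (leavesP w' P) ∧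
        ¬ Dag.B13_main (leavesP w' P) := by
  obtain ⟨w', hw', hl⟩ := exists_record₉C_inEdges_not_b13 h
  refine ⟨w', hw', fun P => ?_⟩
  obtain ⟨h9, h10, h11, h12, hn13⟩ := hl P
  exact ⟨fun _ _ _ _ => h9, fun _ _ _ _ _ _ => h10, fun _ _ _ _ _ => h11,
    fun _ _ _ _ _ _ _ _ => ⟨h12, fun _ hb _ => absurd hb hn13⟩, fun hN => hn13 (hN h9 h10 h11 h12)⟩

/-- **The `∃`-dual at ₉C is junk-provable: given ONE ₉C record, a ₉C record over the same datum at every run of which `b13` — hence N10 — HOLDS** (vacuously: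
module 1's empty-domain step datum). [cite: Balaban1988RG2Cluster, Lemmas 1–3 pp.9, 11, 20 (typed leaf at NODE 00's Stage-9 record; the `∃`-dual is vacuous)] -/
theorem exists_record₉C_b13_main (h : IsRecordOfRecord₉C F N D w) :
    ∃ w' : WorldP, IsRecordOfRecord₉C F N D w' ∧ ∀ P : B12.RunParams, (leavesP w' P).b13 ∧ Dag.B13_main (leavesP w' P) := by
  obtain ⟨θ, -, hrec⟩ := isRecordOfRecord₉C_updXYZ h
  obtain ⟨S₁, hS₁⟩ := exists_stepData_b13Triple
  let X' : B12.RunParams → PrintedCarriersR := fun P => { θ.res.X P with S13 := S₁ }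
  let θ' : Stage5Params F N :=
    Stage9Params.toStage5 F N ({ θ with res := { θ.res with X := X', Y := θ.res.Y, Z := θ.res.Z } } : Stage9Params F N)
  refine ⟨_, hrec X' θ.res.Y θ.res.Z, fun P => ?_⟩
  have h13 : (leavesP { w with up := fun P => upOfRecord₅C F N θ' P } P).b13 :=
    (B13NodeKnitRecord5C.b13_leaf_iff_res₅C F N θ' { w with up := fun P => upOfRecord₅C F N θ' P } P rfl).2 (hS₁ _)
  exact ⟨h13, fun _ _ _ _ => h13⟩

/-- **«N10 at every run of every ₉C record world» is FALSE, given one ₉C record on the family** (= `YMDAG.UVSplit.S_N10` at `Rec := IsRecordOfRecord₉C` fails the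
moment ₉C is inhabited — the plan's analytic item K0). [cite: Balaban1988RG2Cluster, Lemmas 1–3 pp.9, 11, 20 (the universal form of the node over NODE 00's unpinned Stage-9 record is refutable; vacuity probe)] -/
theorem not_forall_record₉C_b13_main (h : IsRecordOfRecord₉C F N D w) :
    ¬ ∀ (D' : FiniteEpsData F (SU N)) (w' : WorldP), IsRecordOfRecord₉C F N D' w' → ∀ P : B12.RunParams, Dag.B13_main (leavesP w' P) := by
  intro hall
  obtain ⟨w', hw', hl⟩ := exists_record₉C_sisters_not_b13_main h
  exact (hl ⟨0, 0, 0⟩).2.2.2.2 (hall D w' hw' _)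

/-- **N10 is UNDETERMINED over `IsRecordOfRecord₉C`** (relative to one ₉C record): it HOLDS at every run of one ₉C record over the datum and FAILS — with all four
in-edge nodes holding — at every run of another. [cite: Balaban1988RG2Cluster, Lemmas 1–3 pp.9, 11, 20; p.1 (independence of the typed node over NODE 00's Stage-9 record predicate; vacuity probe)] -/
theorem b13_main_undetermined_over_record₉C (h : IsRecordOfRecord₉C F N D w) :
    (∃ w' : WorldP, IsRecordOfRecord₉C F N D w' ∧ ∀ P : B12.RunParams, Dag.B13_main (leavesP w' P)) ∧
    (∃ w' : WorldP, IsRecordOfRecord₉C F N D w' ∧ ∀ P : B12.RunParams,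
      Dag.B9_main (leavesP w' P) ∧ Dag.B10_main (leavesP w' P) ∧ Dag.B11_main (leavesP w' P) ∧ Dag.B12_main (leavesP w' P) ∧
        ¬ Dag.B13_main (leavesP w' P)) := by
  obtain ⟨w₁, hw₁, h₁⟩ := exists_record₉C_b13_main h
  exact ⟨⟨w₁, hw₁, fun P => (h₁ P).2⟩, exists_record₉C_sisters_not_b13_main h⟩

/-! ## §3 The slot read at Stage 9 — with the provisos as a premise — is false too -/

/-- **THE SLOT AT STAGE 9 IS FALSE EVEN UNDER THE PROVISOS**: as soon as one admissible Stage-9 parameter `θ₀` satisfying its displayed provisos exists, «for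
every admissible `θ` with provisos and every run, the in-edge leaves at the residual carriers of the view `θ.toStage5` imply the B13 triple of its residual B13
group» is FALSE (swap `θ₀`'s carrier families for module 1's witness: provisos and admissibility survive, §1).  So no N10 closer «from the slot» gains content
by moving from ₅C to ₉C. [cite: Balaban1988RG2Cluster, Lemmas 1–3 pp.9, 11, 20; p.1 (in-edges) (typed leaf at NODE 00's Stage-9 parameters; vacuity probe)] -/
theorem not_slot₉ (θ₀ : Stage9Params F N) (hP₀ : θ₀.Provisos) (h₀ : θ₀.Admissible) :
    ¬ ∀ θ : Stage9Params F N, θ.Admissible → θ.Provisos → ∀ P : B12.RunParams,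
        B9LeafX ((θ.toStage5 F N).res.Y P) →
          (B10.Thm1PrintedCompact ((θ.toStage5 F N).res.X P).runs10 ∧ B10.Thm2Printed ((θ.toStage5 F N).res.X P).runs10) →
            B11Leaf ((θ.toStage5 F N).res.Z P) →
              B12Sec2to5.Lemma4Printed ((θ.toStage5 F N).res.X P).F12 ((θ.toStage5 F N).res.X P).c12 →
                B13.Lemma1Printed ((θ.toStage5 F N).res.X P).S13 ((θ.toStage5 F N).res.X P).c13 ∧
                  B13.Lemma2Printed ((θ.toStage5 F N).res.X P).S13 ((θ.toStage5 F N).res.X P).c13 ∧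
                    B13.Lemma3Printed ((θ.toStage5 F N).res.X P).S13 ((θ.toStage5 F N).res.X P).c13 := by
  intro hslot
  obtain ⟨Y₁, -, -, -, hY₁⟩ := exists_b9LeafX_of_vanishing_operators
  obtain ⟨Z₁, -, hZ₁⟩ := exists_b11Leaf
  let junk : B12.RunParams → B13.StepData := fun P => Classical.choose (exists_stepData_not_lemma1 ((θ₀.res.X P).c13))
  have hjunk : ∀ P, ¬ B13.Lemma1Printed (junk P) ((θ₀.res.X P).c13) := fun P =>
    Classical.choose_spec (exists_stepData_not_lemma1 ((θ₀.res.X P).c13))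
  let X' : B12.RunParams → PrintedCarriersR := fun P =>
    { θ₀.res.X P with I10 := PEmpty, runs10 := (fun i => nomatch i), c12 := ⟨0, 0, 0, 0, 0, 0, 0, 0, 0, 0⟩, S13 := junk P }
  let θ₁ : Stage9Params F N := { θ₀ with res := { θ₀.res with X := X', Y := fun _ => Y₁, Z := fun _ => Z₁ } }
  have h10 : B10.Thm1PrintedCompact ((θ₁.toStage5 F N).res.X ⟨0, 0, 0⟩).runs10 ∧
      B10.Thm2Printed ((θ₁.toStage5 F N).res.X ⟨0, 0, 0⟩).runs10 :=
    ⟨fun _ _ _ _ => ⟨0, (fun i => nomatch i)⟩, (fun i => nomatch i)⟩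
  have h12 : B12Sec2to5.Lemma4Printed ((θ₁.toStage5 F N).res.X ⟨0, 0, 0⟩).F12 ((θ₁.toStage5 F N).res.X ⟨0, 0, 0⟩).c12 :=
    fun hR => absurd hR.1 (lt_irrefl _)
  exact hjunk ⟨0, 0, 0⟩
    (hslot θ₁ (admissible_updXYZ₉ h₀ _ _ _) (provisos_updXYZ₉ hP₀ _ _ _) ⟨0, 0, 0⟩ hY₁ h10 hZ₁ h12).1

/-- **The slot at Stage 9 is false as soon as ₉C is inhabited on the family** (a ₉C record certifies an admissible parameter with provisos:
`Node00.exists_provisos_of_isRecordOfRecord₉C`). [cite: Balaban1988RG2Cluster, Lemmas 1–3 pp.9, 11, 20 (typed leaf at NODE 00's Stage-9 parameters; vacuity probe)] -/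
theorem not_slot₉_of_isRecordOfRecord₉C (h : IsRecordOfRecord₉C F N D w) :
    ¬ ∀ θ : Stage9Params F N, θ.Admissible → θ.Provisos → ∀ P : B12.RunParams,
        B9LeafX ((θ.toStage5 F N).res.Y P) →
          (B10.Thm1PrintedCompact ((θ.toStage5 F N).res.X P).runs10 ∧ B10.Thm2Printed ((θ.toStage5 F N).res.X P).runs10) →
            B11Leaf ((θ.toStage5 F N).res.Z P) →
              B12Sec2to5.Lemma4Printed ((θ.toStage5 F N).res.X P).F12 ((θ.toStage5 F N).res.X P).c12 →
                B13.Lemma1Printed ((θ.toStage5 F N).res.X P).S13 ((θ.toStage5 F N).res.X P).c13 ∧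
                  B13.Lemma2Printed ((θ.toStage5 F N).res.X P).S13 ((θ.toStage5 F N).res.X P).c13 ∧
                    B13.Lemma3Printed ((θ.toStage5 F N).res.X P).S13 ((θ.toStage5 F N).res.X P).c13 := by
  obtain ⟨θ₀, hP₀, h₀, -⟩ := exists_provisos_of_isRecordOfRecord₉C h
  exact not_slot₉ θ₀ hP₀ h₀

end Literature.MathematicalPhysics.QuantumFieldTheory.Balaban1983to89.B13ResidualSlotProbe9

end
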